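import Literature.NumberTheory.EllipticCurves.DeShalit1987.KatzPAdicLFunction
import Literature.NumberTheory.EllipticCurves.IntSeriesValueNormRigidity
import HarnessLib

/-!
# Crux `CycTangentCM.CycTangentBound` (stmt-BirchSwinnertonDyer-22628), negative road: the NORMS of the
# frame values on a power line do NOT depend on the periods `(Ω, δ, Ω_p)` of the typed frame
# (`--supports 22628`; nothing is closed; BSD is not proved by any of this)

Seat `prover-bsd-line-ctcm-p3` g2 (D-0145 line `route-BirchSwinnertonDyer-CycTangentCM`, prover 3/3).  The
negative twin of the crux (lead, `CycTangentBound/Negative/CycTangentBoundFalseOfSplitPrimeLineCertificate`,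
p591225) books `¬ CycTangentBound` modulo a numerical hypothesis `H` that is quantified over ALL typed
frames `(K, ψ, ι, v, v̄, S, κ₁, κ₂, γ₁, γ₂, Ω, δ, Ω_p, G)` of the witness pair, while the numbers were
computed in ONE normalisation.  Two typed frames of the same datum differ in the period triple
`(Ω, δ, Ω_p)`, and the values they prescribe on a power line `t ↦ λΨ^{−Mt}` (type `(−(a + wMt), 0)`),
`x_t = ι⁻¹(interpolationValue p v v̄ S ε_t (a + wMt) 0 Ω δ L_t) · Ω_p^{a + wMt}`, are EXACTLY
proportional: `interpolationValue … m 0 Ω δ L = (Ω^m)⁻¹ · interpolationValue … m 0 1 δ L` and the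
`j = 0` value does not see `δ`, so `x'_t = c^{a + wMt} · x_t` with `c = ι⁻¹(Ω/Ω') · Ω_p' · Ω_p⁻¹`.  By the
norm rigidity of this seat's `IntSeries.norm_values_eq_of_proportional_pow` (p592583: two integral
series read at the same nodes `uᵗ − 1` with proportional values and one non-zero value force `‖c‖ = 1`)
the value NORMS agree: `‖x'_t‖ = ‖x_t‖` for every `t`.  Hence every certificate written in value norms
(`IntSeries.isUnit_coeff_two_of_nodeValues`, `not_cycTangentBound_of_twoPointValues`) holds in every typed
frame as soon as it holds in one — the `∀`-frame form of `H` costs nothing beyond the numerics of one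
frame (and ONE non-vanishing value, e.g. `‖x₂‖ = 7⁻² ≠ 0` at the witness).

* `interpolationValue_zero_eq_inv_pow_mul` — `interpolationValue … m 0 Ω δ L = (Ω^m)⁻¹ · interpolationValue … m 0 1 δ' L`
  (period factored out; `δ, δ'` arbitrary since `j = 0`).
* `frameValue_eq_pow_mul` — the proportionality `x'_t = c^{m} · x_t`, `c = ι⁻¹(Ω/Ω')·Ω_p'·Ω_p⁻¹`.
* `norm_frameValues_eq` — **THE INVARIANCE**: two branches `F, F'` (any integral series, e.g. the
  monomial lines of two typed frames `G, G'`) taking at the nodes `uᵗ − 1` (`u ≠ 1`, `‖u − 1‖ < ‖p‖`)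
  the frame values of `(Ω, δ, Ω_p)` resp. `(Ω', δ', Ω_p')` along a power line of exponents
  `m_t = a + bt`, `b > 0`, with ONE non-zero value, have `‖x'_t‖ = ‖x_t‖` for all `t`.

Theorems only (no definition, no fact, no `sorry`); nothing asserts that frames exist; crux 22628 is
not closed here; BSD is not proved by any of this.
References: [deShalit1987] II.4.16 (50); [Gouvea1993PadicNumbers] §5.6.
-/

set_option linter.dupNamespace false
set_option autoImplicit false

noncomputable section

open scoped NumberField
open NumberField IsDedekindDomain
open Literature.NumberTheory.GaloisRepresentations Literature.NumberTheory.EllipticCurves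

namespace Summit.BirchSwinnertonDyer.BirchSwinnertonDyer.Theorems.CycTangentCMFrameNormRigidity

variable {p : ℕ} [Fact p.Prime] {K : Type} [Field K] [NumberField K]

/-! ### §1. The period factors out of the `j = 0` interpolation value -/

omit [Fact p.Prime] in
/-- **`interpolationValue … m 0 Ω δ L = (Ω^m)⁻¹ · interpolationValue … m 0 1 δ' L`**: at `j = 0` the
complex part of de Shalit's interpolation value (50) is `(Ω^m)⁻¹` times a PERIOD-FREE quantity (and
does not see `δ`). -/
theorem interpolationValue_zero_eq_inv_pow_mul (v vbar : HeightOneSpectrum (𝓞 K))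
    (S : Finset (HeightOneSpectrum (𝓞 K))) (ε : HeckeCharacter K) (m : ℕ) (Ω δ δ' Lval : ℂ) :
    DeShalit1987.interpolationValue p v vbar S ε m 0 Ω δ Lval =
      (Ω ^ m)⁻¹ * DeShalit1987.interpolationValue p v vbar S ε m 0 1 δ' Lval := by
  simp only [DeShalit1987.interpolationValue, add_zero, pow_zero, one_pow, inv_one, mul_one, one_mul]
  ring

/-- **Proportionality of the frame values of two period triples**: with
`x = ι⁻¹(interpolationValue … m 0 Ω δ L)·Ω_p^m` and `x' = ι⁻¹(interpolationValue … m 0 Ω' δ' L)·Ω_p'^m`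
(`Ω, Ω_p ≠ 0`): `x' = c^m · x` with `c = ι⁻¹(Ω/Ω') · Ω_p' · Ω_p⁻¹`. -/
theorem frameValue_eq_pow_mul (ι : PadicAlgCl p ≃+* ℂ) (v vbar : HeightOneSpectrum (𝓞 K))
    (S : Finset (HeightOneSpectrum (𝓞 K))) (ε : HeckeCharacter K) (m : ℕ) {Ω : ℂ} (Ω' δ δ' Lval : ℂ)
    {Ωp : ℂ_[p]} (Ωp' : ℂ_[p]) (hΩ : Ω ≠ 0) (hΩp : Ωp ≠ 0) :
    ((ι.symm (DeShalit1987.interpolationValue p v vbar S ε m 0 Ω' δ' Lval) : PadicAlgCl p) : ℂ_[p]) *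
        Ωp' ^ m =
      (((ι.symm (Ω / Ω') : PadicAlgCl p) : ℂ_[p]) * Ωp' * Ωp⁻¹) ^ m *
        (((ι.symm (DeShalit1987.interpolationValue p v vbar S ε m 0 Ω δ Lval) : PadicAlgCl p) : ℂ_[p]) *
          Ωp ^ m) := by
  set R : ℂ := DeShalit1987.interpolationValue p v vbar S ε m 0 1 δ Lval with hR
  have h1 : DeShalit1987.interpolationValue p v vbar S ε m 0 Ω δ Lval = (Ω ^ m)⁻¹ * R :=
    interpolationValue_zero_eq_inv_pow_mul v vbar S ε m Ω δ δ Lval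
  have h2 : DeShalit1987.interpolationValue p v vbar S ε m 0 Ω' δ' Lval = (Ω' ^ m)⁻¹ * R :=
    interpolationValue_zero_eq_inv_pow_mul v vbar S ε m Ω' δ' δ Lval
  have h3 : (Ω / Ω') ^ m * ((Ω ^ m)⁻¹ * R) = (Ω' ^ m)⁻¹ * R := by
    rw [div_pow, div_eq_mul_inv]
    calc Ω ^ m * (Ω' ^ m)⁻¹ * ((Ω ^ m)⁻¹ * R) = (Ω' ^ m)⁻¹ * R * (Ω ^ m * (Ω ^ m)⁻¹) := by ring
      _ = (Ω' ^ m)⁻¹ * R := by rw [mul_inv_cancel₀ (pow_ne_zero _ hΩ), mul_one]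
  have h12 : DeShalit1987.interpolationValue p v vbar S ε m 0 Ω' δ' Lval =
      (Ω / Ω') ^ m * DeShalit1987.interpolationValue p v vbar S ε m 0 Ω δ Lval := by
    rw [h2, h1, h3]
  have hΩpm : Ωp⁻¹ ^ m * Ωp ^ m = 1 := by
    rw [inv_pow, inv_mul_cancel₀ (pow_ne_zero _ hΩp)]
  rw [h12]
  simp only [map_mul, map_pow, PadicComplex.coe_eq]
  set A : ℂ_[p] := (algebraMap (PadicAlgCl p) ℂ_[p]) (ι.symm (Ω / Ω')) with hA
  set B : ℂ_[p] := (algebraMap (PadicAlgCl p) ℂ_[p])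
    (ι.symm (DeShalit1987.interpolationValue p v vbar S ε m 0 Ω δ Lval)) with hB
  linear_combination (-(A ^ m * B * Ωp' ^ m)) * hΩpm

/-! ### §2. Value norms are invariants of the datum -/

/-- **THE NORMS OF THE FRAME VALUES ON A POWER LINE DO NOT DEPEND ON THE PERIODS.**  Let `F, F'` be
integral series (e.g. the monomial lines `monomialLine (κγ₁) (κγ₂) G`, `… G'` of two typed frames of the
same datum with period triples `(Ω, δ, Ω_p)`, `(Ω', δ', Ω_p')`) taking at the nodes `uᵗ − 1` (`u ≠ 1`,
`‖u − 1‖ < ‖p‖`) the values `x_t = ι⁻¹(interpolationValue p v v̄ S ε_t (a + bt) 0 Ω δ L_t)·Ω_p^{a+bt}`,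
resp. the same with `(Ω', δ', Ω_p')`, for all `t ∈ ℕ` (`b > 0`; `Ω, Ω', Ω_p, Ω_p' ≠ 0`), and suppose ONE
value `x_{t₀} ≠ 0`.  Then `‖x'_t‖ = ‖x_t‖` for every `t`: the values are proportional by `c^{a+bt}`
(`frameValue_eq_pow_mul`) and `‖c‖ = 1` by `IntSeries.norm_values_eq_of_proportional_pow`. -/
theorem norm_frameValues_eq (ι : PadicAlgCl p ≃+* ℂ) (v vbar : HeightOneSpectrum (𝓞 K))
    (S : Finset (HeightOneSpectrum (𝓞 K))) (ε : ℕ → HeckeCharacter K) (L : ℕ → ℂ) {a b : ℕ}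
    (hb : 0 < b) {Ω Ω' δ δ' : ℂ} {Ωp Ωp' : ℂ_[p]} (hΩ : Ω ≠ 0) (hΩ' : Ω' ≠ 0) (hΩp : Ωp ≠ 0)
    (hΩp' : Ωp' ≠ 0) {F F' : PowerSeries (PadicComplexInt p)} {u : ℂ_[p]} (hu1 : u ≠ 1)
    (hup : ‖u - 1‖ < ‖(p : ℂ_[p])‖)
    (hx : ∀ t : ℕ, IntSeries.HasValueAt F (u ^ t - 1)
      (((ι.symm (DeShalit1987.interpolationValue p v vbar S (ε t) (a + b * t) 0 Ω δ (L t)) :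
          PadicAlgCl p) : ℂ_[p]) * Ωp ^ (a + b * t)))
    (hx' : ∀ t : ℕ, IntSeries.HasValueAt F' (u ^ t - 1)
      (((ι.symm (DeShalit1987.interpolationValue p v vbar S (ε t) (a + b * t) 0 Ω' δ' (L t)) :
          PadicAlgCl p) : ℂ_[p]) * Ωp' ^ (a + b * t)))
    {t₀ : ℕ} (h0 : DeShalit1987.interpolationValue p v vbar S (ε t₀) (a + b * t₀) 0 Ω δ (L t₀) ≠ 0)
    (t : ℕ) :
    ‖((ι.symm (DeShalit1987.interpolationValue p v vbar S (ε t) (a + b * t) 0 Ω' δ' (L t)) :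
          PadicAlgCl p) : ℂ_[p]) * Ωp' ^ (a + b * t)‖ =
      ‖((ι.symm (DeShalit1987.interpolationValue p v vbar S (ε t) (a + b * t) 0 Ω δ (L t)) :
          PadicAlgCl p) : ℂ_[p]) * Ωp ^ (a + b * t)‖ := by
  -- norms and the node hypothesis
  have hp1 : ‖(p : ℂ_[p])‖ ≤ 1 := by
    rw [← PadicComplex.coe_natCast p p, PadicComplex.norm_extends p]
    exact PadicAlgCl.norm_natCast_self_lt_one.le
  have hu : ‖u - 1‖ < 1 := hup.trans_le hp1
  have hroot : ∀ n : ℕ, 0 < n → u ^ n ≠ 1 := IntSeries.forall_pow_ne_one_of_norm_sub_one_lt hu1 hup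
  -- the constant of proportionality
  set c : ℂ_[p] := ((ι.symm (Ω / Ω') : PadicAlgCl p) : ℂ_[p]) * Ωp' * Ωp⁻¹ with hc_def
  have hc : c ≠ 0 := by
    have h1 : ((ι.symm (Ω / Ω') : PadicAlgCl p) : ℂ_[p]) ≠ 0 := by
      rw [PadicComplex.coe_eq]
      exact (map_ne_zero _).mpr ((map_ne_zero ι.symm).mpr (div_ne_zero hΩ hΩ'))
    exact mul_ne_zero (mul_ne_zero h1 hΩp') (inv_ne_zero hΩp)
  -- the two value families
  set x : ℕ → ℂ_[p] := fun t ↦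
    ((ι.symm (DeShalit1987.interpolationValue p v vbar S (ε t) (a + b * t) 0 Ω δ (L t)) :
        PadicAlgCl p) : ℂ_[p]) * Ωp ^ (a + b * t) with hx_def
  set x' : ℕ → ℂ_[p] := fun t ↦
    ((ι.symm (DeShalit1987.interpolationValue p v vbar S (ε t) (a + b * t) 0 Ω' δ' (L t)) :
        PadicAlgCl p) : ℂ_[p]) * Ωp' ^ (a + b * t) with hx'_def
  have hrel : ∀ s : ℕ, x' s = c ^ (a + b * s) * x s := fun s ↦
    frameValue_eq_pow_mul ι v vbar S (ε s) (a + b * s) Ω' δ δ' (L s) Ωp' hΩ hΩp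
  have hx0 : x t₀ ≠ 0 := by
    refine mul_ne_zero ?_ (pow_ne_zero _ hΩp)
    rw [PadicComplex.coe_eq]
    exact (map_ne_zero _).mpr ((map_ne_zero ι.symm).mpr h0)
  exact IntSeries.norm_values_eq_of_proportional_pow hu hroot hc hb hx hx' hrel hx0 t

end Summit.BirchSwinnertonDyer.BirchSwinnertonDyer.Theorems.CycTangentCMFrameNormRigidity
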